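import Mathlib
import Literature.MathematicalPhysics.QuantumFieldTheory.Balaban1983to89.B13Ineq232
import Literature.MathematicalPhysics.QuantumFieldTheory.Balaban1983to89.TreeLength

/-!
# `Balaban1983to89.B13Ineq232TreeLength` — the (2.32)-substitute of `…B13Ineq232` as an UNCONDITIONAL theorem for
the formalised tree length `TreeLength.treeLen` of [Balaban1987RG1] p. 257

T. Bałaban, *Renormalization group approach to lattice gauge field theories. II. Cluster expansions*, Commun. Math.
Phys. **116**, 1–22 (1988), doi:10.1007/bf01239022 [Balaban1988RG2Cluster] (cell paper B13; PDF held
`paper:balaban1988-cmp116-rg-ii-cluster`, journal page = PDF page), p. 18 (2.32).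

CITATION HEADER (lean-in-tree rule 2026-08-18).  The passage under audit, p. 18 [PDF 18], verbatim: *"In general the
set Z₀ is a union of connected components. Let us denote one of the components by Z₀. It contains Y₀ = ∪_i Y_i. By a
simple geometric argument we have Σ_i d_k(Y_i) + 4M⁻⁴|Z₀∖Y₀| ≧ d_k(Z₀). (2.32)"* — FALSE with the constant 4 (cell
GAPS.md G-B13-08), no proof printed.  The sibling module `…B13Ineq232` (this unit, p176995) proves the SUBSTITUTE
`d_k(Z₀) ≤ Σ_i d_k(Y_i) + (1 + 2d(1 + c_J))·M⁻⁴|Z₀∖Y₀|` (`CompData.ineq232_subst`) for an ARBITRARY real function `tl`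
on finite index sets satisfying two verbatim-quoted published lemmas entered as hypotheses: `AdjoinLeaf`
([Dimock2013] §4 Lemma 20) and `UnionLeaf c_J` ([Dimock2013], appendix "cluster expansion", proof of Theorem 27:
*"Next we claim that if ∪_{i=1}^n X_i = Y as above, then M d_M(Y) ≤ Σ_{i=1}^n M d_M(X_i) + M(n−1). … Each pair
{X_i, X_j} in this tree will have a block □ in common. For each pair add a line in □ joining the point in τ_i to the
point in τ_j. This line has length at most M. … The minimal tree must have shorter length which is the claim."*).
The sibling module `…TreeLength` (unit `b2b-balaban-pv22`, p177029) FORMALISES the linear size d_j(X) of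
[Balaban1987RG1] p. 257 (*"A length of a shortest graph in this class, divided by M, is the linear size of X, and is
denoted by d_j(X)"*) as `treeLen` (sup metric of [Dimock2013BalabanII] App. E, which is the metric fixed in
[Dimock2013] §2, verbatim: *"The distance is |x−y| = sup_μ |x_μ − y_μ| and we assume L is odd."* — so Dimock's
*"This line has length at most M"* below is exact in his own metric and the constant c_J = 1 of `UnionLeaf` is the
printed one; infimum over connected polygonal graphs, cell DIVERGENCE D-pv22.1) and PROVES `AdjoinLeaf d treeLen`
(`adjoinLeaf_treeLen`).

WHAT IS REPRODUCED HERE (unit `b2b-balaban-pv11`, claim G-B13-08-UNCOND; ~100 lines of glue, nothing existing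
modified).  (1) `unionLeaf_treeLen : UnionLeaf d 1 treeLen` — the n = 2 case of Dimock's claim, PROVED for `treeLen`
exactly as printed: near-optimal admissible graphs for X₁ and X₂ are joined by *"a line in □"* (the common cube) of
sup-length ≤ 1 (`TreeLength.admissible_join_common`, pv22) and the infimum is taken.  (2) Hence the last hypothesis of
`CompData.ineq232_subst` is discharged and the (2.32)-SUBSTITUTE holds UNCONDITIONALLY for the formalised tree length:
`treeLen Z₀ ≤ Σ_{P ∈ parts} treeLen P + (1 + 4d)·|Z₀∖Y₀|` for every datum `CompData d` (a face-connected Z₀ ⊇ the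
pairwise disjoint, pairwise wall-free, face-connected, non-empty components), d = 4: constant 17
(`ineq232_treeLen_four`; the printed constant is 4, the b13 sub-cell's hand repair 18, covered by
`B13.Consts.R16repaired` via `B13Ineq232.seventeen_rate_le_of_R16repaired`).  (3) For the record, Dimock's bound
`|Y|_M ≤ 3^d(1 + d_M(Y))` is NOT used or proved; the metric caveat of `…TreeLength` (i) applies: only the sup-metric
statement (joining constant c_J = 1) is kernel-checked; for the Euclidean / ℓ¹ length the same argument gives c_J = √d /
d (constants 25 / 41 at d = 4 in `…B13Ineq232`), not formalised.

Revision v2.1 (DOCFIX, docstrings only; cross-read C-pv10-11 remarks R1/R2): the limits "_{i=1}^n" restored inside the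
`treeLen_union_le` quotation; [Dimock2013] §2 metric sentence cited above as the printed ground of the sup-metric reading.
Part 4 (revision v2, append-only) proves Dimock's claim IN FULL for `treeLen`: for a non-empty finite collection of
localization domains that *"cannot be divided into two disjoint sets"* (`Indivisible`), `treeLen (⋃ F) ≤ Σ_{X∈F} treeLen X +
(|F| − 1)` (`treeLen_biUnion_le_overlap`; gluing induction `exists_admissible_glue_overlap` on pv22's
`admissible_join_common`), of which the leaf `UnionLeaf` is the case |F| = 2 (`indivisible_pair`).

WHAT IS *NOT* ASSERTED.  Nothing of the series: (2.32) as printed stays typed-for-the-record in `…B13Ineq232`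
(`Ineq232Printed`, used nowhere) and is NOT refuted in the kernel here (the cell's counterexample, GAPS.md G-B13-08, is
by hand); `treeLen` is pv22's reading of d_j (conventions (i)–(iii) of that module: sup metric, connected polygonal
graphs instead of trees — so `treeLen ≤` the printed d_j —, infimum not shown attained).  Value = located-gap repair
made unconditional for one explicit reading of d_k (kernel-checked bookkeeping), NOT summit progress.  Staged
byte-identically in the cell package `run/shared/lean/pub/pub-balaban/lean/BalabanYm4/Literature/…/B13Ineq232TreeLength.lean`.
-/

noncomputable section

namespace Literature.MathematicalPhysics.QuantumFieldTheory.Balaban1983to89.B13Ineq232TreeLength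

open Literature.MathematicalPhysics.QuantumFieldTheory.Balaban1983to89
open Literature.MathematicalPhysics.QuantumFieldTheory.Balaban1983to89.B13ScaleTransfer
open Literature.MathematicalPhysics.QuantumFieldTheory.Balaban1983to89.B13Ineq232
open Literature.MathematicalPhysics.QuantumFieldTheory.Balaban1983to89.TreeLength

variable {d : ℕ}

/-! ## Part 1. The union leaf for `treeLen` ([Dimock2013], proof of Theorem 27, the case n = 2) -/

/-- A localization domain (non-empty, face-connected) has an admissible graph (pv22's `exists_admissible`, length
bound dropped). [cite: Balaban1987RG1, p.257 (linear size d_j)] -/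
theorem nonempty_admissible {X : Finset (Pt d)} (hX : X.Nonempty) (hc : FaceConnected X) : ∃ T, Admissible X T := by
  obtain ⟨T, hT, -⟩ := exists_admissible hX hc
  exact ⟨T, hT⟩

/-- [Dimock2013], appendix "cluster expansion", proof of Theorem 27, verbatim: *"Next we claim that if ∪_{i=1}^n X_i =
Y as above, then M d_M(Y) ≤ Σ_{i=1}^n M d_M(X_i) + M(n−1). Indeed let τ_i be a minimal tree on X_i of length M d_M(X_i).
… Each pair {X_i, X_j} in this tree will have a block □ in common. For each pair add a line in □ joining the point in
τ_i to the point in τ_j. This line has length at most M. The tree graph consisting of the τ_i and the (n−1) extra lines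
now joins all the blocks in Y and has length less than Σ_{i=1}^n M d_M(X_i) + M(n−1). The minimal tree must have
shorter length which is the claim."* — the case n = 2, PROVED for `treeLen` (unit cubes, sup metric: the joining line has length ≤ 1;
minimal trees replaced by near-optimal admissible graphs and the infimum taken, since the infimum is not shown to be
attained): for localization domains X₁, X₂ with a common cube, `treeLen (X₁ ∪ X₂) ≤ treeLen X₁ + treeLen X₂ + 1`. [cite: Dimock2013, proof of Thm. 27 (tree-length inequality for overlapping families)] -/
theorem treeLen_union_le {X₁ X₂ : Finset (Pt d)} (h₁ : X₁.Nonempty) (h₂ : X₂.Nonempty) (hc₁ : FaceConnected X₁)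
    (hc₂ : FaceConnected X₂) (hI : (X₁ ∩ X₂).Nonempty) :
    treeLen (X₁ ∪ X₂) ≤ treeLen X₁ + treeLen X₂ + 1 := by
  obtain ⟨c, hc⟩ := hI
  rw [Finset.mem_inter] at hc
  refine le_of_forall_pos_le_add fun ε hε => ?_
  obtain ⟨T₁, hT₁, hlt₁⟩ := exists_admissible_len_lt (nonempty_admissible h₁ hc₁) (half_pos hε)
  obtain ⟨T₂, hT₂, hlt₂⟩ := exists_admissible_len_lt (nonempty_admissible h₂ hc₂) (half_pos hε)
  obtain ⟨T, hT, hlen⟩ := admissible_join_common hT₂ hT₁ hc.2 hc.1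
  linarith [treeLen_le_len hT]

/-- LEAF `UnionLeaf` of `…B13Ineq232` DISCHARGED: `UnionLeaf d 1 treeLen` holds as a theorem (joining constant
c_J = 1, sup metric). [cite: Dimock2013, proof of Thm. 27 (tree-length inequality for overlapping families)] -/
theorem unionLeaf_treeLen : UnionLeaf d 1 (treeLen (d := d)) :=
  fun _ _ h₁ h₂ hc₁ hc₂ hI => treeLen_union_le h₁ h₂ hc₁ hc₂ hI

/-! ## Part 2. The (2.32)-substitute, unconditionally, for `treeLen` -/

/-- THE (2.32)-SUBSTITUTE FOR THE FORMALISED TREE LENGTH — for (2.32) p. 18, verbatim *"Σ_i d_k(Y_i) + 4M⁻⁴|Z₀∖Y₀| ≧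
d_k(Z₀)"* (FALSE with 4, cell GAPS.md G-B13-08), the kernel-checked replacement with NO hypothesis on the length
function left: for a face-connected Z₀ containing the pairwise disjoint, pairwise wall-free, non-empty face-connected
components P ∈ parts (at least one), `treeLen Z₀ ≤ Σ_{P ∈ parts} treeLen P + (1 + 4d)·|Z₀∖Y₀|` (both leaves of
`CompData.ineq232_subst` — `AdjoinLeaf` by pv22's `adjoinLeaf_treeLen`, `UnionLeaf 1` by `unionLeaf_treeLen` — are now
theorems; 1 + 2d(1 + c_J) = 1 + 4d at c_J = 1). [cite: Balaban1988RG2Cluster, (2.32) p.18] -/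
theorem ineq232_treeLen (D : CompData d) (hne : D.parts.Nonempty) :
    treeLen D.Z₀ ≤ ∑ P ∈ D.parts, treeLen P + (1 + 4 * (d : ℝ)) * (D.W.card : ℝ) := by
  have h := D.ineq232_subst hne (by norm_num : (-1 : ℝ) ≤ 1) adjoinLeaf_treeLen unionLeaf_treeLen
  have h17 : (1 + 2 * (d : ℝ) * (1 + 1)) = 1 + 4 * (d : ℝ) := by ring
  rw [h17] at h
  exact h

/-- d = 4 (the series): `treeLen Z₀ ≤ Σ_{P ∈ parts} treeLen P + 17·|Z₀∖Y₀|` — the constant 17 in place of the printed 4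
(the b13 sub-cell's hand repair: 18; `B13.Consts.R16repaired` covers 17, `B13Ineq232.seventeen_rate_le_of_R16repaired`).
[cite: Balaban1988RG2Cluster, (2.32) p.18] -/
theorem ineq232_treeLen_four (D : CompData 4) (hne : D.parts.Nonempty) :
    treeLen D.Z₀ ≤ ∑ P ∈ D.parts, treeLen P + 17 * (D.W.card : ℝ) :=
  D.ineq232_four_sup hne adjoinLeaf_treeLen unionLeaf_treeLen

/-- The one-component case (n = 1: Y₀ = Y₁ connected, the situation of a single polymer), where the substitute reads
`treeLen Z₀ ≤ treeLen Y₁ + (1 + 4d)·|Z₀∖Y₁|` — in fact the sharper adjoining bound with constant 1 holds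
(pv22's `treeLen_le_card_sdiff_add`, [Dimock2013] §4 Lemma 20); recorded to make the comparison explicit. [cite: Dimock2013, §4 Lemma 20] -/
theorem treeLen_le_of_single {Y Z : Finset (Pt d)} (hY : Y.Nonempty) (hYZ : Y ⊆ Z) (hYc : FaceConnected Y)
    (hZc : FaceConnected Z) : treeLen Z ≤ treeLen Y + ((Z \ Y).card : ℝ) := by
  have h := treeLen_le_card_sdiff_add hY hYZ hYc hZc
  linarith

/-! ## Part 3. The two consumptions of (2.32), now with the geometric input a theorem (d = 4) -/

/-- (2.33) p. 19, the case Y₀ ≠ ∅ (`B13Ineq232.case_nonempty_233`), with the geometric input (2.32) supplied by the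
THEOREM `ineq232_treeLen_four` instead of a hypothesis: for a datum `D : CompData 4` with at least one
component, `0 ≤ ε₂ ≤ 1`, rate `r ≥ 0`, `a ≥ 0` and the smallness `17·r ≤ a/20`,
`Π_{P} (ε₂ e^{−r·treeLen P}) · e^{−(a/10)|Z₀∖Y₀|} ≤ ε₂ · e^{−r·treeLen Z₀}`. [cite: Balaban1988RG2Cluster, (2.33) p.19] -/
theorem case_nonempty_233_treeLen (D : CompData 4) (hne : D.parts.Nonempty) {ε₂ r a : ℝ} (hε₀ : 0 ≤ ε₂)
    (hε₁ : ε₂ ≤ 1) (hr : 0 ≤ r) (ha : 0 ≤ a) (h16 : 17 * r ≤ a / 20) :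
    (∏ P ∈ D.parts, ε₂ * Real.exp (-(r * treeLen P))) * Real.exp (-(a / 10 * (D.W.card : ℝ))) ≤
      ε₂ * Real.exp (-(r * treeLen D.Z₀)) :=
  case_nonempty_233 D.parts hne (fun P => treeLen P) (ineq232_treeLen_four D hne) hε₀ hε₁ hr ha
    (Nat.cast_nonneg _) h16

/-- p. 20 after (2.37), *"Using the inequality (2.32), properly adapted to the new situation"*
(`B13Ineq232.adapted_p20`), with the adapted (2.32) supplied by the THEOREM `ineq232_treeLen_four` one scale up
(Z ∈ 𝐃_{k+1} face-connected, parts = the connected components Z′_i of Z′₀, W = the LM-cubes of Z∖Z′₀): for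
`0 ≤ A ≤ 1`, rate `r ≥ 0`, `b = κ₁ − 1` with `17·r ≤ b/2`,
`e^{−b|Z∖Z′₀|} · Π_i (A e^{−r·treeLen Z′_i}) ≤ A · e^{−r·treeLen Z} · e^{−(b/2)|Z∖Z′₀|}`. [cite: Balaban1988RG2Cluster, p.20 (after (2.37))] -/
theorem adapted_p20_treeLen (D : CompData 4) (hne : D.parts.Nonempty) {A r b : ℝ} (hA₀ : 0 ≤ A)
    (hA₁ : A ≤ 1) (hr : 0 ≤ r) (hb : 17 * r ≤ b / 2) :
    Real.exp (-(b * (D.W.card : ℝ))) * ∏ P ∈ D.parts, A * Real.exp (-(r * treeLen P)) ≤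
      A * Real.exp (-(r * treeLen D.Z₀)) * Real.exp (-(b / 2 * (D.W.card : ℝ))) :=
  adapted_p20 D.parts hne (fun P => treeLen P) (ineq232_treeLen_four D hne) hA₀ hA₁ hr (Nat.cast_nonneg _) hb

/-! ## Part 4 (revision v2, append-only). Dimock's claim for n overlapping polymers, PROVED for `treeLen` -/

/-- [Dimock2013], appendix "cluster expansion", proof of Theorem 27, verbatim: *"Here the product over X is written
as a sum over collections of distinct polymers {X_i}. … In this sum we require that the {X_i} cannot be divided
into two disjoint sets."* — typed for a finite SET `F` of index sets (distinct polymers): every splitting of `F` into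
a non-empty part `G` and its non-empty complement has a polymer of `G` meeting a polymer outside `G` (equivalently:
the two unions are not disjoint). [cite: Dimock2013, proof of Thm. 27 (tree-length inequality for overlapping families)] -/
def Indivisible (F : Finset (Finset (Pt d))) : Prop :=
  ∀ G, G ⊆ F → G.Nonempty → (F \ G).Nonempty → ∃ X ∈ G, ∃ X' ∈ F \ G, (X ∩ X').Nonempty

/-- GLUING INDUCTION for Dimock's claim (the printed mechanism: *"consider the connected graph whose edges are pairs
{X_i, X_j} such that X_i ∩ X_j ≠ ∅. Take a tree which is a subgraph with (n−1) edges. Each pair {X_i, X_j} in this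
tree will have a block □ in common. For each pair add a line in □ joining the point in τ_i to the point in τ_j. This
line has length at most M."* — realised by growing a glued sub-collection `G` one polymer at a time: indivisibility
supplies a polymer outside `G` sharing a cube with one inside, and `TreeLength.admissible_join_common` (pv22) joins
it at cost ≤ 1): from admissible graphs `f X` of the members and a glued admissible graph for the union of `G` of
length ≤ Σ_{X∈G} len(f X) + (|G| − 1), the whole collection glues at length ≤ Σ_{X∈F} len(f X) + (|F| − 1). [cite: Dimock2013, proof of Thm. 27 (tree-length inequality for overlapping families)] -/
theorem exists_admissible_glue_overlap {F : Finset (Finset (Pt d))} (hF : Indivisible F)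
    {f : Finset (Pt d) → List (Seg d)} (hf : ∀ X ∈ F, Admissible X (f X)) :
    ∀ n : ℕ, ∀ G : Finset (Finset (Pt d)), G ⊆ F → G.Nonempty → (F \ G).card = n →
      (∃ T, Admissible (G.biUnion id) T ∧ len T ≤ ∑ X ∈ G, len (f X) + ((G.card : ℝ) - 1)) →
      ∃ T, Admissible (F.biUnion id) T ∧ len T ≤ ∑ X ∈ F, len (f X) + ((F.card : ℝ) - 1) := by
  intro n
  induction n with
  | zero =>
    intro G hGF _ hcard hT
    have hGeq : G = F :=
      Finset.Subset.antisymm hGF (Finset.sdiff_eq_empty_iff_subset.1 (Finset.card_eq_zero.1 hcard))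
    subst hGeq
    exact hT
  | succ n ih =>
    intro G hGF hGne hcard hT
    obtain ⟨T, hT, hlen⟩ := hT
    have hne : (F \ G).Nonempty := by
      rw [← Finset.card_pos, hcard]
      exact Nat.succ_pos n
    obtain ⟨X, hXG, X', hX', c, hc⟩ := hF G hGF hGne hne
    rw [Finset.mem_sdiff] at hX'
    rw [Finset.mem_inter] at hc
    have hcU : c ∈ G.biUnion id := Finset.mem_biUnion.2 ⟨X, hXG, hc.1⟩
    obtain ⟨T₁, hT₁, hlen₁⟩ := admissible_join_common hT (hf X' hX'.1) hcU hc.2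
    have hsub : insert X' G ⊆ F := Finset.insert_subset hX'.1 hGF
    have hcard' : (F \ insert X' G).card = n := by
      rw [Finset.sdiff_insert, Finset.card_erase_of_mem (Finset.mem_sdiff.2 ⟨hX'.1, hX'.2⟩), hcard]
      simp
    refine ih (insert X' G) hsub (Finset.insert_nonempty _ _) hcard' ⟨T₁, ?_, ?_⟩
    · rw [Finset.biUnion_insert]
      exact hT₁
    · rw [Finset.sum_insert hX'.2, Finset.card_insert_of_notMem hX'.2]
      push_cast
      linarith

/-- Dimock's claim, graph form: admissible graphs `f X` of the members of a non-empty indivisible finite collection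
`F` of polymers glue to an admissible graph for ⋃ F of length ≤ Σ_{X∈F} len(f X) + (|F| − 1) — *"The tree graph
consisting of the τ_i and the (n−1) extra lines now joins all the blocks in Y and has length less than
Σ_{i=1}^n M d_M(X_i) + M(n−1)."* [cite: Dimock2013, proof of Thm. 27 (tree-length inequality for overlapping families)] -/
theorem exists_admissible_biUnion_overlap {F : Finset (Finset (Pt d))} (hFne : F.Nonempty) (hF : Indivisible F)
    {f : Finset (Pt d) → List (Seg d)} (hf : ∀ X ∈ F, Admissible X (f X)) :
    ∃ T, Admissible (F.biUnion id) T ∧ len T ≤ ∑ X ∈ F, len (f X) + ((F.card : ℝ) - 1) := by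
  obtain ⟨X₁, hX₁⟩ := hFne
  refine exists_admissible_glue_overlap hF hf _ {X₁} (Finset.singleton_subset_iff.2 hX₁)
    (Finset.singleton_nonempty _) rfl ⟨f X₁, ?_, ?_⟩
  · rw [Finset.singleton_biUnion]
    exact hf X₁ hX₁
  · simp

/-- DIMOCK'S CLAIM IN FULL, PROVED for `treeLen` — [Dimock2013], appendix "cluster expansion", proof of Theorem 27,
verbatim: *"Next we claim that if ∪_{i=1}^n X_i = Y as above, then M d_M(Y) ≤ Σ_{i=1}^n M d_M(X_i) + M(n−1). …
The minimal tree must have shorter length which is the claim."*: for a non-empty finite collection `F` of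
localization domains (non-empty, face-connected index sets) that *"cannot be divided into two disjoint sets"*
(`Indivisible F`), `treeLen (⋃ F) ≤ Σ_{X∈F} treeLen X + (|F| − 1)` (unit cubes, sup metric; minimal trees replaced
by near-optimal admissible graphs and the infimum taken).  The case |F| = 2 is `treeLen_union_le` / the leaf
`UnionLeaf d 1 treeLen`; no connectivity hypothesis on ⋃ F is needed (it follows). [cite: Dimock2013, proof of Thm. 27 (tree-length inequality for overlapping families)] -/
theorem treeLen_biUnion_le_overlap {F : Finset (Finset (Pt d))} (hFne : F.Nonempty) (hF : Indivisible F)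
    (hmem : ∀ X ∈ F, X.Nonempty ∧ FaceConnected X) :
    treeLen (F.biUnion id) ≤ ∑ X ∈ F, treeLen X + ((F.card : ℝ) - 1) := by
  refine le_of_forall_pos_le_add fun ε hε => ?_
  have hFpos : (0 : ℝ) < F.card := by exact_mod_cast Finset.card_pos.2 hFne
  obtain ⟨δ, hδpos, hδ⟩ : ∃ δ : ℝ, 0 < δ ∧ (F.card : ℝ) * δ = ε :=
    ⟨ε / F.card, div_pos hε hFpos, by field_simp⟩
  have hch : ∀ X ∈ F, ∃ T, Admissible X T ∧ len T < treeLen X + δ := fun X hX =>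
    exists_admissible_len_lt (nonempty_admissible (hmem X hX).1 (hmem X hX).2) hδpos
  choose! f hf hflen using hch
  obtain ⟨T, hT, hlen⟩ := exists_admissible_biUnion_overlap hFne hF hf
  have h1 := treeLen_le_len hT
  have h2 : ∑ X ∈ F, len (f X) ≤ ∑ X ∈ F, (treeLen X + δ) :=
    Finset.sum_le_sum fun X hX => (hflen X hX).le
  rw [Finset.sum_add_distrib, Finset.sum_const, nsmul_eq_mul] at h2
  linarith

/-- The two-polymer collection {X₁, X₂} with a common cube is indivisible. [folklore] -/
theorem indivisible_pair {X₁ X₂ : Finset (Pt d)} (hI : (X₁ ∩ X₂).Nonempty) :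
    Indivisible ({X₁, X₂} : Finset (Finset (Pt d))) := by
  intro G hGF hGne hne
  obtain ⟨A, hA⟩ := hGne
  obtain ⟨B, hB⟩ := hne
  rw [Finset.mem_sdiff] at hB
  have hAF := hGF hA
  simp only [Finset.mem_insert, Finset.mem_singleton] at hAF
  have hBF := hB.1
  simp only [Finset.mem_insert, Finset.mem_singleton] at hBF
  have hAB : A ≠ B := fun h => hB.2 (h ▸ hA)
  refine ⟨A, hA, B, Finset.mem_sdiff.2 ⟨hB.1, hB.2⟩, ?_⟩
  rcases hAF with rfl | rfl <;> rcases hBF with rfl | rfl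
  · exact absurd rfl hAB
  · exact hI
  · rwa [Finset.inter_comm]
  · exact absurd rfl hAB

end Literature.MathematicalPhysics.QuantumFieldTheory.Balaban1983to89.B13Ineq232TreeLength

end
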